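import Mathlib
import Summits.CriticalPhenomena.CardyFormulaZ2.Theses.CardyMagicRigidity
import Summits.CriticalPhenomena.CardyFormulaZ2.Theses.CardyBondTriangular
import Literature.Probability.LatticeModels.IsoradialPercolation
import Literature.Probability.LatticeModels.TriangularLattice
import Literature.Probability.Percolation.CardyFormula

/-!
# Sketch — crux-ideate stmt-CriticalPhenomena-4833 (LoopLimitZ2EqT), ideator k = 2

First lemmas of the two crux ideas, stated over existing declarations (not proved).

* Lever A (`hex-segment-odd-channel`): the self-dual triangular hyperlattice segment `M_t`,
  `t ∈ [0,1]` = density of "bond-type" up-triangles; `t = 0` is site percolation on `𝕋`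
  (all-or-nothing up-triangles of `𝕋̃ = triGraph`), `t = 1` is i.i.d. critical bond
  percolation on `𝕋̃` at `criticalWeightI (π/6) = 2 sin(π/18)`.
* Lever B (`kagome-arena-track-insertion`): bond-`𝕋̃` ↝ bond-`ℤ²` by track insertion
  (crossing level = CardyBondTriangular.TriangularToSquareTransport; loop level needs D1).
-/

noncomputable section

namespace Summit.CriticalPhenomena.CardyFormulaZ2.Cruxes.LoopLimitZ2EqT.HexSegment

open Literature.Probability.LatticeModels Literature.Probability.Percolation
open Literature.Probability.RandomPlanarGeometry
open MeasureTheory Filter Set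

/-- Coins: per up-triangle `x : Site 2` a type bit (`none`), a fair coin (`some none`) and three
bond coins (`some (some k)`), `k : Fin 3`. -/
abbrev Coin : Type := Site 2 × Option (Option (Fin 3))

/-- Parameters of the product Bernoulli measure on coins: type bit `t`, fair coin `1/2`,
bond coins `p_c(𝕋̃) = criticalWeight (π/6) = 2 sin(π/18)`. -/
def prm (t : unitInterval) : Coin → unitInterval := fun i =>
  match i.2 with
  | none => t
  | some none => half
  | some (some _) => criticalWeightI (Real.pi / 6)

/-- The three edges of the up-triangle of `triGraph` at `x`: `{x, x+e₀}`, `{x, x+e₁}`,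
`{x+e₀, x+e₁}` (every edge of `triGraph` lies in exactly one up-triangle). -/
def upEdge (x : Site 2) (k : Fin 3) : Sym2 (Site 2) :=
  if k = 0 then s(x, x + ![1, 0]) else if k = 1 then s(x, x + ![0, 1]) else s(x + ![1, 0], x + ![0, 1])

/-- The bond configuration of a coin set: a bond-type unit (`(x,none) ∈ S`) opens edge `k` iff its
bond coin `k` is heads; a site-type unit opens ALL three edges iff its fair coin is heads. -/
def cfg (S : Set Coin) : BondConfig (Site 2) :=
  {e | ∃ (x : Site 2) (k : Fin 3), e = upEdge x k ∧
      (((x, (none : Option (Option (Fin 3)))) ∈ S ∧ (x, some (some k)) ∈ S) ∨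
       ((x, (none : Option (Option (Fin 3)))) ∉ S ∧ (x, some (none : Option (Fin 3))) ∈ S))}

/-- Crude crossing probability of the conformal rectangle `R` at mesh `δ` for the segment model
`M_t` (equilateral embedding `triEmbed`). -/
def segCross (t : unitInterval) (R : ConformalRectangle) (δ : ℝ) : ℝ :=
  (prodBernoulli (prm t)).real {S | cfg S ∈ embDomainCrossing triEmbed R.carrier δ (R.arc 0) (R.arc 2)}

/-- Same, as a function of a real parameter (projected to `[0,1]`), to speak of `d/dt`. -/
def segCrossℝ (t : ℝ) (R : ConformalRectangle) (δ : ℝ) : ℝ :=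
  segCross (Set.projIcc (0 : ℝ) 1 zero_le_one t) R δ

/-- FIRST LEMMA (lever A, conclusion at crossing level): **segment flatness** — along the
self-dual triangular hyperlattice segment every crossing probability is asymptotically
independent of the bond-type density `t`. -/
def HexSegmentFlat : Prop :=
  ∀ (t : unitInterval) (R : ConformalRectangle),
    Tendsto (fun δ : ℝ ↦ segCross t R δ - segCross 0 R δ) (nhdsWithin 0 (Set.Ioi 0)) (nhds 0)

/-- FIRST LEMMA (lever A, first checkable step): **the Smirnov end is stationary** — the
right-derivative in the bond-type density at `t = 0` (site-`𝕋`) of every crossing probability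
vanishes in the scaling limit (Russo sum = (1/3)·pivotal attachment asymmetry; at `t = 0` the
colour flip and `R_{π/3}` are separately symmetries). -/
def SmirnovEndStationary : Prop :=
  ∀ R : ConformalRectangle,
    Tendsto (fun δ : ℝ ↦ derivWithin (fun t : ℝ ↦ segCrossℝ t R δ) (Set.Ici 0) 0)
      (nhdsWithin 0 (Set.Ioi 0)) (nhds 0)

/-- Uniform version needed for the line (Russo integral): the derivative is `o(1)` uniformly in
`t ∈ [0,1]` — equivalently the pivotal attachment asymmetry `A_t(R, δ) → 0` uniformly. -/
def UniformAttachmentSymmetry : Prop :=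
  ∀ R : ConformalRectangle, ∀ ε > 0, ∃ δ₀ > 0, ∀ δ ∈ Set.Ioo 0 δ₀, ∀ t ∈ Set.Icc (0 : ℝ) 1,
    |derivWithin (fun t' : ℝ ↦ segCrossℝ t' R δ) (Set.Icc 0 1) t| < ε

/-- Endpoint dictionary, `t = 1`: `M_1` has the crude crossing probabilities of i.i.d. critical
bond percolation on `triGraph` (same law of `cfg`). -/
def BondEnd : Prop :=
  ∀ (R : ConformalRectangle) (δ : ℝ),
    segCross 1 R δ = (bondPercolation triGraph (criticalWeightI (Real.pi / 6))).real
      (embDomainCrossing triEmbed R.carrier δ (R.arc 0) (R.arc 2))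

/-- Endpoint dictionary, `t = 0`: `M_0` crossings have the same Cardy limits as site percolation
on `𝕋` (Smirnov's theorem, proved in tree as `hasCrossingLimit_triDomainCrossingProb_holds`,
transported through "all-or-nothing up-triangles of 𝕋̃ = sites of the triangular lattice of
up-triangles" and a crude-vs-G02 discretisation bridge). -/
def SiteEnd : Prop :=
  ∀ R : ConformalRectangle, R.HasCrossingLimit (segCross 0 R) Literature.Probability.RandomPlanarGeometry.cardyFunction

/-- Glue of lever A at crossing level: flatness + the two endpoint dictionaries give Cardy for
critical bond percolation on `𝕋̃` in the `triEmbed` normalisation (the anchor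
`BondTriangularCardy` of route CardyBondTriangular, up to its `√3`-rescaled embedding). -/
theorem bondTriangularCardy_of (hflat : HexSegmentFlat) (h1 : BondEnd) (h0 : SiteEnd) :
    ∀ R : ConformalRectangle,
      R.HasCrossingLimit (fun δ ↦ (bondPercolation triGraph (criticalWeightI (Real.pi / 6))).real
        (embDomainCrossing triEmbed R.carrier δ (R.arc 0) (R.arc 2))) Literature.Probability.RandomPlanarGeometry.cardyFunction := by
  intro R φ x hux
  have h := (hflat 1 R).add (h0 R φ x hux)
  simp only [sub_add_cancel, zero_add] at h
  refine h.congr' (Eventually.of_forall fun δ => ?_)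
  exact h1 R δ

/-- Lever B, crossing level: the existing transport item of route CardyBondTriangular
(stmt-CriticalPhenomena-…, `TriangularToSquareTransport`), quoted by name. The loop-level
(`d_CN`) version — the statement lever B actually wants — needs a loop representation of bond
configurations on `triGraph` (definition request D1 `triBondLoopConfig`). -/
def TriToSquareCrossings : Prop :=
  Summit.CriticalPhenomena.CardyFormulaZ2.Theses.CardyBondTriangular.TriangularToSquareTransport

/-- The crux, quoted by name (the target both levers serve). -/
example : Prop := Summit.CriticalPhenomena.CardyFormulaZ2.Theses.CardyMagicRigidity.LoopLimitZ2EqT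

end Summit.CriticalPhenomena.CardyFormulaZ2.Cruxes.LoopLimitZ2EqT.HexSegment
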